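import Summits.PneNP.PneNP.Theorems.ConvexRankGatesConvexGateBlindExactLiftingTrianglePlaneLocalAdd

/-!
# Triangle instance — plane-local factorisations: linear necessity (orthogonal weights have balanced margins)

Support file for crux `ConvexGateBlind` (stmt-PneNP-10680), open stub `stub_exactLifting` (prover seat 3, session 15);
sequel of `…TrianglePlaneLocalAdd` (`AddSolves H`, the exact ε-free form of the plane-local dictionary problem).
The first rigidity of `AddSolves`: a weight matrix `w` orthogonal to every atom of the dictionary pairs to zero with
`X₀ − X₁ = α ⊕ β`, and that pairing is `∑ a, α a · (row margin of w at a) + ∑ d, β d · (column margin at d)`; at a pair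
`(P,S)` whose classes are sign-compatible with the margins every term is `≥ 0`, so all margins vanish
(`addSolves_orth_margins`).  Consequence (memo `PLANELOCAL-seat3.md` §2(b), counting done there): the linear span of a
solving dictionary meets the additive matrices in dimension `≥ 2t − 2`, and a dictionary in general position with respect
to the additive matrices needs `t² − 1 − O(t / log t)` atoms.  Nothing here is cited; everything is elementary.
-/

set_option linter.dupNamespace false -- `Summit.PneNP.PneNP.…`: summit = sub-problem (D-0017)

namespace Summit.PneNP.PneNP.Theorems.XorDoor.TriLine

open Finset

variable {t : ℕ}

/-- Pairing a weight matrix with an additive matrix `α ⊕ β` splits into row and column margins. -/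
theorem sum_mul_additive_eq_margins (w : Fin t → Fin t → ℝ) (α β : Fin t → ℝ) :
    ∑ a, ∑ d, w a d * (α a + β d) = ∑ a, α a * ∑ d, w a d + ∑ d, β d * ∑ a, w a d := by
  have h1 : ∑ a, ∑ d, w a d * (α a + β d) = ∑ a, ∑ d, α a * w a d + ∑ a, ∑ d, β d * w a d := by
    rw [← sum_add_distrib]
    refine sum_congr rfl fun a _ => ?_
    rw [← sum_add_distrib]
    exact sum_congr rfl fun d _ => by ring
  rw [h1]
  congr 1
  · exact sum_congr rfl fun a _ => (mul_sum _ _ _).symm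
  · rw [sum_comm]
    exact sum_congr rfl fun d _ => (mul_sum _ _ _).symm

/-- A weight matrix orthogonal to every atom is orthogonal to the additive difference `X₀ − X₁ = α ⊕ β` of any two
non-negative (indeed any two) combinations of the atoms. -/
theorem sum_mul_additive_eq_zero_of_orth {ι : Type} [Fintype ι] {H : ι → Fin t → Fin t → ℝ}
    (w : Fin t → Fin t → ℝ) (hw : ∀ i, ∑ a, ∑ d, w a d * H i a d = 0) {c₀ c₁ : ι → ℝ} {α β : Fin t → ℝ}
    (hadd : ∀ a d, ∑ i, c₀ i * H i a d - ∑ i, c₁ i * H i a d = α a + β d) :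
    ∑ a, ∑ d, w a d * (α a + β d) = 0 := by
  calc ∑ a, ∑ d, w a d * (α a + β d) = ∑ a, ∑ d, ∑ i, (c₀ i - c₁ i) * (w a d * H i a d) := by
        refine sum_congr rfl fun a _ => sum_congr rfl fun d _ => ?_
        rw [← hadd a d, ← sum_sub_distrib, mul_sum]
        exact sum_congr rfl fun i _ => by ring
    _ = ∑ a, ∑ i, ∑ d, (c₀ i - c₁ i) * (w a d * H i a d) := sum_congr rfl fun a _ => sum_comm
    _ = ∑ i, ∑ a, ∑ d, (c₀ i - c₁ i) * (w a d * H i a d) := sum_comm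
    _ = ∑ i, (c₀ i - c₁ i) * ∑ a, ∑ d, w a d * H i a d := by
        refine sum_congr rfl fun i _ => ?_
        rw [mul_sum]
        exact sum_congr rfl fun a _ => (mul_sum _ _ _).symm
    _ = 0 := by simp [hw]

/-- **Linear necessity.**  Let the dictionary satisfy `AddSolves`, let `w` be orthogonal to every atom, and let `(P,S)`
be an admissible pair (all four classes non-empty) that is sign-compatible with the margins of `w`: row margins `≥ 0`
on `P` and `≤ 0` off `P`, column margins `≥ 0` on `S` and `≤ 0` off `S`.  Then every row margin and every column
margin of `w` is zero.  (Such a pair exists unless the row margins or the column margins are all strictly of one sign;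
so the orthogonal complement of the span of a solving dictionary contains, besides doubly balanced matrices, at most
those — memo §2(b).) -/
theorem addSolves_orth_margins {ι : Type} [Fintype ι] {H : ι → Fin t → Fin t → ℝ} (hA : AddSolves H)
    (w : Fin t → Fin t → ℝ) (hw : ∀ i, ∑ a, ∑ d, w a d * H i a d = 0) {P S : Fin t → Bool}
    (hP₁ : ∃ a, P a = true) (hP₂ : ∃ a, P a = false) (hS₁ : ∃ d, S d = true) (hS₂ : ∃ d, S d = false)
    (hrP : ∀ a, P a = true → 0 ≤ ∑ d, w a d) (hrN : ∀ a, P a = false → ∑ d, w a d ≤ 0)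
    (hsP : ∀ d, S d = true → 0 ≤ ∑ a, w a d) (hsN : ∀ d, S d = false → ∑ a, w a d ≤ 0) :
    (∀ a, ∑ d, w a d = 0) ∧ (∀ d, ∑ a, w a d = 0) := by
  obtain ⟨c₀, c₁, α, β, -, -, hadd, hαP, hαN, hβP, hβN, -, -⟩ := hA P S hP₁ hP₂ hS₁ hS₂
  have h0 := sum_mul_additive_eq_zero_of_orth w hw hadd
  rw [sum_mul_additive_eq_margins] at h0
  -- every term is non-negative
  have hαr : ∀ a, 0 ≤ α a * ∑ d, w a d := by
    intro a
    cases hPa : P a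
    · exact mul_nonneg_of_nonpos_of_nonpos (le_of_lt (hαN a hPa)) (hrN a hPa)
    · exact mul_nonneg (le_of_lt (hαP a hPa)) (hrP a hPa)
  have hβs : ∀ d, 0 ≤ β d * ∑ a, w a d := by
    intro d
    cases hSd : S d
    · exact mul_nonneg_of_nonpos_of_nonpos (le_of_lt (hβN d hSd)) (hsN d hSd)
    · exact mul_nonneg (le_of_lt (hβP d hSd)) (hsP d hSd)
  have hA0 : 0 ≤ ∑ a, α a * ∑ d, w a d := sum_nonneg fun a _ => hαr a
  have hB0 : 0 ≤ ∑ d, β d * ∑ a, w a d := sum_nonneg fun d _ => hβs d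
  have hA1 : ∑ a, α a * ∑ d, w a d = 0 := by linarith
  have hB1 : ∑ d, β d * ∑ a, w a d = 0 := by linarith
  rw [sum_eq_zero_iff_of_nonneg fun a _ => hαr a] at hA1
  rw [sum_eq_zero_iff_of_nonneg fun d _ => hβs d] at hB1
  have hαne : ∀ a, α a ≠ 0 := by
    intro a
    cases hPa : P a
    · exact ne_of_lt (hαN a hPa)
    · exact ne_of_gt (hαP a hPa)
  have hβne : ∀ d, β d ≠ 0 := by
    intro d
    cases hSd : S d
    · exact ne_of_lt (hβN d hSd)
    · exact ne_of_gt (hβP d hSd)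
  refine ⟨fun a => ?_, fun d => ?_⟩
  · have := hA1 a (mem_univ a)
    rcases mul_eq_zero.mp this with h | h
    · exact absurd h (hαne a)
    · exact h
  · have := hB1 d (mem_univ d)
    rcases mul_eq_zero.mp this with h | h
    · exact absurd h (hβne d)
    · exact h

/-- The admissible sign-compatible pair always exists for the ROW side unless the row margins are all strictly positive
or all strictly negative: with `2 ≤ t`, some proper non-empty `P` has margins `≥ 0` on `P` and `≤ 0` off `P`. -/
theorem exists_signCompatible (ht : 2 ≤ t) (r : Fin t → ℝ) (h₁ : ¬ ∀ a, 0 < r a) (h₂ : ¬ ∀ a, r a < 0) :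
    ∃ P : Fin t → Bool, (∃ a, P a = true) ∧ (∃ a, P a = false) ∧
      (∀ a, P a = true → 0 ≤ r a) ∧ (∀ a, P a = false → r a ≤ 0) := by
  push Not at h₁ h₂
  obtain ⟨a₁, ha₁⟩ := h₁
  obtain ⟨a₂, ha₂⟩ := h₂
  by_cases hex : ∃ a, a ≠ a₁ ∧ 0 ≤ r a
  · -- P := the non-negative rows other than a₁
    obtain ⟨a₃, ha₃, hr₃⟩ := hex
    refine ⟨fun a => decide (a ≠ a₁ ∧ 0 ≤ r a), ⟨a₃, by simpa using ⟨ha₃, hr₃⟩⟩, ⟨a₁, by simp⟩, ?_, ?_⟩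
    · intro a ha
      have := (decide_eq_true_iff).mp ha
      exact this.2
    · intro a ha
      have hna : ¬ (a ≠ a₁ ∧ 0 ≤ r a) := by simpa using ha
      by_cases haa : a = a₁
      · rw [haa]; exact ha₁
      · push Not at hna
        exact le_of_lt (hna haa)
  · -- every row other than a₁ is negative; then a₂ = a₁ has margin 0; P := {a₁}
    push Not at hex
    have h21 : a₂ = a₁ := by
      by_contra hne
      exact absurd ha₂ (not_le.mpr (hex a₂ hne))
    obtain ⟨b, hb⟩ : ∃ b : Fin t, b ≠ a₁ := by
      by_contra hno
      push Not at hno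
      have hsub : Finset.univ ⊆ ({a₁} : Finset (Fin t)) := fun x _ => by simp [hno x]
      have := Finset.card_le_card hsub
      simp at this
      omega
    refine ⟨fun a => decide (a = a₁), ⟨a₁, by simp⟩, ⟨b, by simpa using hb⟩, ?_, ?_⟩
    · intro a ha
      have hEq : a = a₁ := by simpa using ha
      rw [hEq, ← h21]; exact ha₂
    · intro a ha
      have hne : a ≠ a₁ := by simpa using ha
      exact le_of_lt (hex a hne)

/-- Registered form (stub `triangle_planeLocal_orth` of stmt-PneNP-10680): linear necessity of `AddSolves` —
weights orthogonal to every atom have vanishing margins at any admissible sign-compatible pair. -/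
theorem triangle_planeLocal_orth : ∀ {t : ℕ} {ι : Type} [Fintype ι] {H : ι → Fin t → Fin t → ℝ}, AddSolves H → ∀ (w : Fin t → Fin t → ℝ), (∀ i, ∑ a, ∑ d, w a d * H i a d = 0) → ∀ (P S : Fin t → Bool), (∃ a, P a = true) → (∃ a, P a = false) → (∃ d, S d = true) → (∃ d, S d = false) → (∀ a, P a = true → 0 ≤ ∑ d, w a d) → (∀ a, P a = false → ∑ d, w a d ≤ 0) → (∀ d, S d = true → 0 ≤ ∑ a, w a d) → (∀ d, S d = false → ∑ a, w a d ≤ 0) → (∀ a, ∑ d, w a d = 0) ∧ (∀ d, ∑ a, w a d = 0) :=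
  fun hA w hw _ _ hP₁ hP₂ hS₁ hS₂ hrP hrN hsP hsN => addSolves_orth_margins hA w hw hP₁ hP₂ hS₁ hS₂ hrP hrN hsP hsN

end Summit.PneNP.PneNP.Theorems.XorDoor.TriLine
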